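import Summits.BirchSwinnertonDyer.Rank1Residual.Additive.X3TwistedDatumLine
import Summits.BirchSwinnertonDyer.Rank1Residual.Additive.X3TwistedDatumDevissage
import Summits.BirchSwinnertonDyer.Rank1Residual.Additive.GreenbergVatsalTorsionRamifiedQuotient
import Summits.BirchSwinnertonDyer.Rank1Residual.Additive.GreenbergVatsalTransferCountThree
import Summits.BirchSwinnertonDyer.Rank1Residual.Additive.GordGreenbergKummerIdentification
import Summits.BirchSwinnertonDyer.Rank1Residual.AdditivePotMult.MuLambdaTransferRamifiedOrdinaryOfRecords
import Summits.BirchSwinnertonDyer.Rank1Residual.X1.LambdaSqueezeAlgebra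
import Literature.NumberTheory.EllipticCurves.GreenbergVatsal2000.ResidualLifting
import Literature.NumberTheory.EllipticCurves.GreenbergVatsal2000.CongruentCurves
import HarnessLib
/-!
# X3 on the semistable-twist locus, cell (G-ord, `e = 2`): THE ALGEBRAIC COUNT `hAlgW` —
# Greenberg–Vatsal's display (16) with (11) for `Sel_{p^∞}(E/ℚ_∞)` at the ADDITIVE prime — from
# PUBLISHED named facts, in the kernel (cell `bsd-addord`, seat `bsd-addord-twist`, strategy = twist
# transport; memo v2.1 §7 road map (c′)+assembly; sequel of `X3TwistedDatumLine.lean`)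

HONEST FRAMING (cell `bsd-addord`, `run/shared/lean/pub/bsd-addord/README.md` §4): the programme's
target of record is the full Birch–Swinnerton-Dyer formula for every `E/ℚ` of analytic rank `≤ 1`;
this file concerns the X3 rows (`E[p]` reducible) of cell (G-ord, `e = 2`) of N10 only. THEOREMS ONLY
(no `def`, no named fact, no `sorry`); nothing is booked by this file. Every PUBLISHED input enters as
a displayed named-fact binder: `h23` (GV 2000 §2 Cor. (2.3) + Prop. (2.4) at the datum,
`datumSelmer_nonPrimitive_invariants`), `h414` (Greenberg 1999 Prop. 4.14,
`prop414_noFiniteSubmodule_of_not_dvd_torsionOrder`), `hGrK` (Greenberg 1999 Props. 2.2/2.4,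
`imKummer_ge_strictCondition_goodOrdinary`), `hLiftF` (GV 2000 p. 28 with p. 30,
`residualEpsilon_surjOn_of_lineRamifiedEven`).

## What and why

The seat's end-state files `X3BranchAnalyticHalfGordDescent[EndState].lean` reduce `BSD(E,p)` on the
X3 ∩ (G-ord, `e = 2`) ∩ `r_an = 0` rows to PRINT and ONE displayed count `hAlgW` about the Selmer
group of the additive curve `W = E` over the cyclotomic `ℤ_p`-extension:
`p^{λ(g) + Σ_{ℓ∈Σ₀} δ_ℓ(W)} = #H¹(ℚ_Σ/ℚ_∞, Φ₀)·#U(W[p]/Φ₀)` for every `Λ`-dual datum `D` of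
`Sel_{p^∞}(W/ℚ_∞)` and generator `g` of `char_Λ D.X` with `μ(g) = 0` (Greenberg–Vatsal (16)+(11)).
THIS FILE PROVES that count (with the torsion-ness of `D.X` displayed as a hypothesis — a CONCLUSION
of Wuthrich's Thm. 16 at the call site, see the sibling `X3BranchMainConjectureGordOfFacts.lean`)
from the four published records above, by running Greenberg–Vatsal's §2 at the TWISTED Greenberg
datum of `W = C • V^{(p*)}` (`V` good ordinary): `C = t(C_v(V))` with `t : V[p^∞] ≃ W[p^∞]` the
geometric twist transport (`+` on `Gal(ℚ̄/ℚ(√p*))`, `−` off it).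

Steps (d′) — the `p`-torsion plus-part of the twisted datum IS the even line `Φ₀`
(`exists_data_isRamifiedOrdinaryLine_plus_eq_lineSub`) — and `p ∤ #W(ℚ)_tors`
(`not_dvd_torsionOrder_of_line`) are the sibling `X3TwistedDatumLine.lean`. Here:

* §1 **`natCard_line_mul_quotSelmer_eq_of_goodOrd_pStar_twist`** — GV (16)+(11) for `W`:
  `#H¹(ℚ_Σ/ℚ_∞, Φ₀)·#U = p^{λ(X(W/ℚ_∞)) + Σδ}` for `X` torsion with `μ = 0`. Chain: R-D identity
  (`ramifiedLineKummerEqAt_of_goodOrd_pStar_twist`, mod `hGrK`) ⟹ `Sel = S_A`, `Sel^{Σ₀} = S^{Σ₀}_A`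
  (`selmerInfty_eq_datumSelmerInfty`); `h23` in classical currency (`record_consequences_of_eq`:
  `λ(X^{Σ₀}) = λ(X) + Σδ`, `μ(X^{Σ₀}) = μ(X) = 0`, `Sel^{Σ₀}/Sel` divisible); `h414` ⟹ no finite
  submodule ⟹ `#Sel^{Σ₀}[p] = p^{λ(X^{Σ₀})}`; GV Prop. (2.8)/Remark (2.9) torsion comparison
  (`natCard_gvSelmer_torsion_curve_of_invariants_eq_bot_of_finite`, correction factor `1`);
  display (16) (`X3TwistedDatum.natCard_gvSelmer_torsion_eq_mul_of_plus_eq_line` with the sibling's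
  (d′) and `hLiftF`).
* §2 **`X3Branch.algebraicCountW_of_facts`** — the displayed `hAlgW` of the end-state files WITH the
  torsion binder, in its exact shape (`lam g`, `residualLineH1`, `residualQuotSelmer`), for every
  quadratic-`K` reading of "`χ`-twist ramified".

## What this is NOT

Not the (M) cell (there `V` is multiplicative: the Tate datum replaces `reductionDatum`, and the
analytic half `hGVM` is not in print); not `p = 3`'s non-degenerate rows with `Φ₀` UNRAMIFIED at `3`
(the lifting fact `hLiftF` is typed for a ramified even line); not a class theorem (the sibling
assembles the end state); no label, tier or count of record moves.

References: [GreenbergVatsal2000] §2 Prop. (2.1), Cor. (2.3), Prop. (2.4), (2.5), Remark (2.7),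
Prop. (2.8), Remark (2.9), pp. 26–30 (display (16), (11)); [GreenbergLNM1716] Props. 2.2, 2.4, 4.14;
[EmertonPollackWeston2006] §3.1 (the line datum); [SilvermanAEC2009] X.5 Cor. 5.4 (twist transport).
-/


set_option autoImplicit false

noncomputable section

open scoped Classical AddSubgroup

namespace Summit.BirchSwinnertonDyer.Rank1Residual.Additive

open NumberField IsDedekindDomain Field WeierstrassCurve
  Literature.NumberTheory.GaloisRepresentations
  Literature.NumberTheory.EllipticCurves
  Literature.NumberTheory.EllipticCurves.GreenbergSelmer
  Literature.NumberTheory.EllipticCurves.GreenbergVatsal2000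
  Literature.NumberTheory.EllipticCurves.EmertonPollackWeston2006
  Literature.NumberTheory.EllipticCurves.Rank1Residual
  Summit.BirchSwinnertonDyer.Rank1Residual.X2
  Summit.BirchSwinnertonDyer.Rank1Residual.X2.GreenbergVatsalTorsion
  Summit.BirchSwinnertonDyer.Rank1Residual.X2.GreenbergVatsalReductionDatum
  Summit.BirchSwinnertonDyer.Rank1Residual.X2.ResidualDevissageLine
  Summit.BirchSwinnertonDyer.Rank1Residual.X1.MuLambda
  Summit.BirchSwinnertonDyer.Rank1Residual.GaloisImage.RamifiedOrdinaryLineTwist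
  Summit.BirchSwinnertonDyer.Rank1Residual.AdditivePotMult
  Summit.BirchSwinnertonDyer.Rank1Residual.AdditivePotMult.RamifiedOrdinaryLinePotMult
  Summit.BirchSwinnertonDyer.Rank1Residual.Additive.TameDescent


/-! ### §1 Greenberg–Vatsal's (16)+(11) for the ADDITIVE `W = C • V^{(p*)}`, from the four records -/

section Count

variable {p : ℕ} [hp : Fact p.Prime] {W : WeierstrassCurve ℚ} [W.IsElliptic] [W.IsGloballyMinimal]

/-- **GV (16)+(11) for `Sel_{p^∞}(W/ℚ_∞)` at the ADDITIVE prime, from PRINT.** `p` odd; `V` globally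
minimal GOOD ORDINARY at `p` with `C • V^{(p*)} = W`; `K` quadratic with `θ² = p*`, `θ ∉ ℚ`; `Σ₀ ∌ p`
finite with the bad places `≠ p` inside; `Φ₀ ≤ W[p]` a rational line RAMIFIED at `p`, EVEN, with
ramified `χ_K`-twist; `κ` cyclotomic with topological generator `γ`; `D` ANY `Λ`-dual datum of
`Sel_{p^∞}(W/ℚ_∞)` whose module is TORSION with `μ = 0`. THEN
`#H¹(ℚ_Σ/ℚ_∞, Φ₀) · #U(W[p]/Φ₀) = p^{λ(D.X) + Σ_{v∈Σ₀} δ_v(W)}` — GRANTED the published records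
`h23` (GV Cor. (2.3)/Prop. (2.4) at the datum), `h414` (Greenberg Prop. 4.14), `hGrK` (Greenberg
Props. 2.2/2.4) and `hLiftF` (GV p. 28/30 lifting). Chain in the module docstring (§1).
[cite: GreenbergVatsal2000, §2 pp. 26–30 (display (16), (11)), Prop. (2.8), Remark (2.9), Cor. (2.3), Prop. (2.4)]
[cite: GreenbergLNM1716, Props. 2.2, 2.4 (pp. 73–75), Prop. 4.14] -/
theorem natCard_line_mul_quotSelmer_eq_of_goodOrd_pStar_twist
    (h23 : datumSelmer_nonPrimitive_invariants)
    (h414 : Greenberg1999.prop414_noFiniteSubmodule_of_not_dvd_torsionOrder)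
    (hGrK : Greenberg1999.imKummer_ge_strictCondition_goodOrdinary)
    (hLiftF : residualEpsilon_surjOn_of_lineRamifiedEven)
    (hp2 : p ≠ 2) (V : WeierstrassCurve ℚ) [V.IsElliptic] [V.IsGloballyMinimal] (hV : GoodOrd V p)
    {C : VariableChange ℚ} (hC : C • V.quadraticTwist ((-1 : ℚ) ^ (p / 2) * p) = W)
    (K : Type) [Field K] [NumberField K] [(galRange (K := ℚ) K).Normal]
    (h2 : Module.finrank ℚ K = 2) {θ : K} (hθ : θ ∉ Set.range (algebraMap ℚ K))
    (hc : θ ^ 2 = algebraMap ℚ K ((-1) ^ (p / 2) * p))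
    (S₀ : Finset (HeightOneSpectrum (𝓞 ℚ))) (hS₀ : ∀ v ∈ S₀, ((p : ℕ) : 𝓞 ℚ) ∉ v.asIdeal)
    (hS : ∀ v : HeightOneSpectrum (𝓞 ℚ), v ∉ S₀ → ((p : ℕ) : 𝓞 ℚ) ∉ v.asIdeal →
      W.HasGoodReductionAt v)
    {Φ₀ : AddSubgroup (W.geomTorsion (p : ℤ))} (hΦ : IsRationalLine W p Φ₀)
    (hram0 : ¬ LineUnramifiedAt W p Φ₀) (heven : LineEven W p Φ₀)
    (hram : ¬ ∀ w : HeightOneSpectrum (𝓞 ℚ), ((p : ℕ) : 𝓞 ℚ) ∈ w.asIdeal →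
      ∀ 𝔓 ∈ w.primesAbove, ∀ σ ∈ 𝔓.inertia (absoluteGaloisGroup ℚ), ∀ P ∈ Φ₀,
        σ • P = (if σ ∈ galRange (K := ℚ) K then P else -P))
    {κ : ZpExtension ℚ p} {γ : absoluteGaloisGroup ℚ} (hκ : κ.IsCyclotomic) (hγ : κ.IsTopGenerator γ)
    (D : W.SelmerDualData κ γ) [Module.Finite (IwasawaAlgebra p) D.X] (hDt : D.IsTorsion)
    (hμ : D.mu = 0) :
    Nat.card (residualLineH1 W p κ S₀ Φ₀ hΦ) * Nat.card (residualQuotSelmer W p κ S₀ Φ₀ hΦ) =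
      p ^ (lambdaInvariant p D.X + ∑ v ∈ S₀, delta W p v) := by
  have hS₀' : ∀ v ∈ (↑S₀ : Set (HeightOneSpectrum (𝓞 ℚ))), ((p : ℕ) : 𝓞 ℚ) ∉ v.asIdeal :=
    fun v hv ↦ hS₀ v (Finset.mem_coe.mp hv)
  have hS' : ∀ v : HeightOneSpectrum (𝓞 ℚ), v ∉ (↑S₀ : Set (HeightOneSpectrum (𝓞 ℚ))) →
      ((p : ℕ) : 𝓞 ℚ) ∉ v.asIdeal → W.HasGoodReductionAt v :=
    fun v hv hpv ↦ hS v (fun h ↦ hv (Finset.mem_coe.2 h)) hpv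
  -- the twisted Greenberg data: ramified ordinary lines whose `p`-torsion plus-part is `Φ₀`
  obtain ⟨Lf, hLf, hplus⟩ :=
    exists_data_isRamifiedOrdinaryLine_plus_eq_lineSub V K h2 hθ p hc hC hp2 hV hΦ hram
  -- R-D identification at the ramified ordinary lines (mod `hGrK`)
  have hRD : ∀ (v : HeightOneSpectrum (𝓞 ℚ)) (hv : ((p : ℕ) : 𝓞 ℚ) ∈ v.asIdeal),
      (Lf v hv).greenbergKer κ.kerSubgroup = W.localKerOver p κ.kerSubgroup (v.adicCompletion ℚ) :=
    fun v hv ↦ ramifiedLineKummerEqAt_of_goodOrd_pStar_twist p hGrK hp2 V ⟨C, hC⟩ hV κ hκ v hv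
      (Lf v hv) (hLf v hv)
  -- no rational `p`-torsion
  have htors : ¬ p ∣ W.torsionOrder := not_dvd_torsionOrder_of_line hΦ hp2 hram0 heven
  -- `Sel = S_A`, `Sel^{Σ₀} = S^{Σ₀}_A`
  have hSel := selmerInfty_eq_datumSelmerInfty W p κ hp2 hκ Lf hRD
  have hNP := nonPrimitiveSelmerInfty_eq_datumSelmerInfty W p κ
    (↑S₀ : Set (HeightOneSpectrum (𝓞 ℚ))) hp2 hκ Lf hRD hS₀'
  -- the record in classical currency on X2's non-primitive dual
  set DS := X2.NonPrimitiveSelmerDual.nonPrimitiveDualData W κ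
    (↑S₀ : Set (HeightOneSpectrum (𝓞 ℚ))) hγ with hDS
  obtain ⟨hfg, ht, hμS, hlamS, hdiv⟩ :=
    record_consequences_of_eq h23 hp2 hκ hγ Lf hLf htors S₀ hS₀ hSel hNP D hDt DS
  haveI := hfg
  have hμS' : muInvariant p DS.X = 0 := by rw [hμS]; exact hμ
  -- no finite submodule (Greenberg 4.14) ⟹ `#Sel^{Σ₀}[p] = p^{λ(X^{Σ₀})} = p^{λ(X) + Σδ}`
  have hnf := nonPrimitive_noFiniteSubmodule_of_prop414 h414 htors hκ hγ D hDt DS hdiv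
  have hcount := natCard_torsionBy_nonPrimitiveSelmerInfty_eq_pow_lambdaInvariant κ
    (↑S₀ : Set (HeightOneSpectrum (𝓞 ℚ))) DS ht hμS' hnf
  rw [hlamS, natCard_torsionBy_nonPrimitiveSelmerInfty_eq_of_greenbergKer_eq W p κ
    (↑S₀ : Set (HeightOneSpectrum (𝓞 ℚ))) hp2 hκ Lf hRD hS₀' hS'] at hcount
  -- GV Prop. (2.8) / Remark (2.9): `#S^{Σ₀}_{W[p]} = #(S^{Σ₀}_{W[p^∞]} ⊓ H¹[p]) · 1`
  haveI := finite_fixedPoints_of_not_dvd_torsionOrder W κ htors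
  have h28 := GreenbergVatsalTorsionRamified.natCard_gvSelmer_torsion_curve_of_invariants_eq_bot_of_finite
    W p κ.kerSubgroup Lf (↑S₀ : Set (HeightOneSpectrum (𝓞 ℚ))) hS'
    (fun v hv ↦ fun c hc' ↦ (hLf v hv).divisible hc')
    (RamifiedOrdinaryLineQuotientModelFree.data_gr_invariants_eq_zero_of_isRamifiedOrdinaryLine hp2 κ
      Lf hLf)
  rw [natCard_torsionBy_fixedPoints_eq_one W κ htors, mul_one] at h28
  -- display (16) at the twisted datum
  obtain ⟨c, hcc⟩ := exists_isComplexConjugation (Rat.castHom ℝ)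
  have hdev := X3TwistedDatum.natCard_gvSelmer_torsion_eq_mul_of_plus_eq_line hΦ hp2 heven Lf hplus
    (↑S₀ : Set (HeightOneSpectrum (𝓞 ℚ))) hS' κ.kerSubgroup
    (ResidualDevissageLine.mem_kerSubgroup_of_isComplexConjugation κ hcc) hcc
    (hLiftF W p κ S₀ Φ₀ hΦ hp2 hκ hram0 heven hS₀ hS)
  -- assembly
  change Nat.card (GreenbergVatsal2000.unramifiedOutside κ.kerSubgroup (lineSub Φ₀ hΦ).Sub p
      (↑S₀ : Set (HeightOneSpectrum (𝓞 ℚ)))) *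
    Nat.card (ResidualDevissageSelmer.quotSelmer κ.kerSubgroup (lineSub Φ₀ hΦ).Quot p
      (↑S₀ : Set (HeightOneSpectrum (𝓞 ℚ)))) = _
  rw [← hdev, h28]
  rw [gvSelmerInfty] at hcount
  exact hcount

end Count

/-! ### §2 The displayed `hAlgW` of `X3BranchAnalyticHalfGordDescent[EndState].lean`, WITH the torsion binder -/

section AlgW

variable {p : ℕ} [hp : Fact p.Prime] {W : WeierstrassCurve ℚ} [W.IsElliptic] [W.IsGloballyMinimal]

/-- **`hAlgW` (torsion-displayed form) FROM PRINT, for one quadratic `K`.** `p` odd; `V` good ordinary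
at `p` with `C • V^{(p*)} = W`; `K ∋ θ`, `θ² = p*`, `θ ∉ ℚ`; `Σ₀`, `Φ₀` (rational line, ramified at
`p`, even, ramified `χ_K`-twist) as in §1. THEN for every cyclotomic `κ`, topological generator `γ`,
`Λ`-dual datum `D` of `Sel_{p^∞}(W/ℚ_∞)` with `D.X` TORSION, and generator `g` of `char_Λ D.X` with
`μ(g) = 0`: `p^{λ(g) + Σ_{v∈Σ₀} δ_v(W)} = #H¹(ℚ_Σ/ℚ_∞, Φ₀)·#U(W[p]/Φ₀)` — GV (16)+(11) for the additive
`W`. (`λ(g) = λ(D.X)` and `μ(D.X) = 0 ↔ μ(g) = 0` for a generator: tree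
`lam_generator_eq_lambdaInvariant`, `mu_eq_zero_iff_hasUnitContent`; `D.X` is finitely generated:
`module_finite_holds`.) Records: `h23`, `h414`, `hGrK`, `hLiftF`.
[cite: GreenbergVatsal2000, §2 pp. 26–30 (display (16), (11))] [cite: GreenbergLNM1716, Props. 2.2, 2.4, 4.14] -/
theorem X3Branch.algebraicCountW_of_facts_of_field
    (h23 : datumSelmer_nonPrimitive_invariants)
    (h414 : Greenberg1999.prop414_noFiniteSubmodule_of_not_dvd_torsionOrder)
    (hGrK : Greenberg1999.imKummer_ge_strictCondition_goodOrdinary)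
    (hLiftF : residualEpsilon_surjOn_of_lineRamifiedEven)
    (hp2 : p ≠ 2) (V : WeierstrassCurve ℚ) [V.IsElliptic] [V.IsGloballyMinimal] (hV : GoodOrd V p)
    {C : VariableChange ℚ} (hC : C • V.quadraticTwist ((-1 : ℚ) ^ (p / 2) * p) = W)
    (K : Type) [Field K] [NumberField K] [(galRange (K := ℚ) K).Normal]
    (h2 : Module.finrank ℚ K = 2) {θ : K} (hθ : θ ∉ Set.range (algebraMap ℚ K))
    (hc : θ ^ 2 = algebraMap ℚ K ((-1) ^ (p / 2) * p))
    (S₀ : Finset (HeightOneSpectrum (𝓞 ℚ))) (hS₀ : ∀ v ∈ S₀, ((p : ℕ) : 𝓞 ℚ) ∉ v.asIdeal)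
    (hS : ∀ v : HeightOneSpectrum (𝓞 ℚ), v ∉ S₀ → ((p : ℕ) : 𝓞 ℚ) ∉ v.asIdeal →
      W.HasGoodReductionAt v)
    (Φ₀ : AddSubgroup (W.geomTorsion (p : ℤ))) (hΦ : IsRationalLine W p Φ₀)
    (hram0 : ¬ LineUnramifiedAt W p Φ₀) (heven : LineEven W p Φ₀)
    (hram : ¬ ∀ w : HeightOneSpectrum (𝓞 ℚ), ((p : ℕ) : 𝓞 ℚ) ∈ w.asIdeal →
      ∀ 𝔓 ∈ w.primesAbove, ∀ σ ∈ 𝔓.inertia (absoluteGaloisGroup ℚ), ∀ P ∈ Φ₀,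
        σ • P = (if σ ∈ galRange (K := ℚ) K then P else -P))
    {κ : ZpExtension ℚ p} {γ : absoluteGaloisGroup ℚ} (D : W.SelmerDualData κ γ)
    (g : IwasawaAlgebra p) (hκ : κ.IsCyclotomic) (hγ : κ.IsTopGenerator γ) (hDt : D.IsTorsion)
    (hchar : D.charIdeal = Ideal.span {g}) (hμg : HasUnitContent g) :
    p ^ (lam g + ∑ v ∈ S₀, delta W p v) =
      Nat.card (residualLineH1 W p κ S₀ Φ₀ hΦ) * Nat.card (residualQuotSelmer W p κ S₀ Φ₀ hΦ) := by
  haveI : Module.Finite (IwasawaAlgebra p) D.X := D.module_finite_holds hγ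
  have hg0 : g ≠ 0 := X11a.ne_zero_of_hasUnitContent hμg
  have hμ : D.mu = 0 := (mu_eq_zero_iff_hasUnitContent D hDt hchar).mpr hμg
  have hlam : lam g = lambdaInvariant p D.X :=
    X1.ParitySqueeze.lam_generator_eq_lambdaInvariant D.X hDt hg0 hchar
  rw [hlam]
  exact (natCard_line_mul_quotSelmer_eq_of_goodOrd_pStar_twist h23 h414 hGrK hLiftF hp2 V hV hC K h2
    hθ hc S₀ hS₀ hS hΦ hram0 heven hram hκ hγ D hDt hμ).symm

/-- **`hAlgW` (torsion-displayed form) FROM PRINT — the `∀ K` reading of "`χ`-twist ramified" used by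
the end-state files.** As `X3Branch.algebraicCountW_of_facts_of_field`, with the ramified-twist
hypothesis stated for EVERY quadratic `K` with `θ² = p*` (the binder `hram` of
`X3Branch.charIdeal_eq_span_of_thm312_of_algebraicCountW`); instantiated at `ℚ(√p*) ⊂ ℚ(ζ_p)`.
[cite: GreenbergVatsal2000, §2 pp. 26–30 (display (16), (11))] [cite: GreenbergLNM1716, Props. 2.2, 2.4, 4.14] -/
theorem X3Branch.algebraicCountW_of_facts
    (h23 : datumSelmer_nonPrimitive_invariants)
    (h414 : Greenberg1999.prop414_noFiniteSubmodule_of_not_dvd_torsionOrder)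
    (hGrK : Greenberg1999.imKummer_ge_strictCondition_goodOrdinary)
    (hLiftF : residualEpsilon_surjOn_of_lineRamifiedEven)
    (hp2 : p ≠ 2) (V : WeierstrassCurve ℚ) [V.IsElliptic] [V.IsGloballyMinimal] (hV : GoodOrd V p)
    {C : VariableChange ℚ} (hC : C • V.quadraticTwist ((-1 : ℚ) ^ (p / 2) * p) = W)
    (S₀ : Finset (HeightOneSpectrum (𝓞 ℚ))) (hS₀ : ∀ v ∈ S₀, ((p : ℕ) : 𝓞 ℚ) ∉ v.asIdeal)
    (hS : ∀ v : HeightOneSpectrum (𝓞 ℚ), v ∉ S₀ → ((p : ℕ) : 𝓞 ℚ) ∉ v.asIdeal →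
      W.HasGoodReductionAt v)
    (Φ₀ : AddSubgroup (W.geomTorsion (p : ℤ))) (hΦ : IsRationalLine W p Φ₀)
    (hram0 : ¬ LineUnramifiedAt W p Φ₀) (heven : LineEven W p Φ₀)
    (hram : ∀ (K : Type) [Field K] [NumberField K] [(galRange (K := ℚ) K).Normal],
      Module.finrank ℚ K = 2 → (∃ θ : K, θ ^ 2 = algebraMap ℚ K ((-1) ^ (p / 2) * p)) →
      ¬ ∀ v : HeightOneSpectrum (𝓞 ℚ), ((p : ℕ) : 𝓞 ℚ) ∈ v.asIdeal →
        ∀ 𝔓 ∈ v.primesAbove, ∀ σ ∈ 𝔓.inertia (absoluteGaloisGroup ℚ), ∀ P ∈ Φ₀,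
          σ • P = (if σ ∈ galRange (K := ℚ) K then P else -P))
    {κ : ZpExtension ℚ p} {γ : absoluteGaloisGroup ℚ} (D : W.SelmerDualData κ γ)
    (g : IwasawaAlgebra p) (hκ : κ.IsCyclotomic) (hγ : κ.IsTopGenerator γ) (hDt : D.IsTorsion)
    (hchar : D.charIdeal = Ideal.span {g}) (hμg : HasUnitContent g) :
    p ^ (lam g + ∑ v ∈ S₀, delta W p v) =
      Nat.card (residualLineH1 W p κ S₀ Φ₀ hΦ) * Nat.card (residualQuotSelmer W p κ S₀ Φ₀ hΦ) := by
  obtain ⟨K, _, _, h2, θ, hθ, hc⟩ := exists_numberField_sq_eq_pStar (p := p) hp2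
  haveI : IsGalois ℚ K := isGalois_of_finrank_eq_two K h2
  haveI : (galRange (K := ℚ) K).Normal := normal_galRange K h2 (sigmaQ_ne_one K h2 hθ hc)
  exact X3Branch.algebraicCountW_of_facts_of_field h23 h414 hGrK hLiftF hp2 V hV hC K h2 hθ hc S₀ hS₀
    hS Φ₀ hΦ hram0 heven (hram K h2 ⟨θ, hc⟩) D g hκ hγ hDt hchar hμg

end AlgW

end Summit.BirchSwinnertonDyer.Rank1Residual.Additive

end
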